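import Literature.AlgebraicGeometry.Motives.MixedHodgeStructureCatWeightTruncation
import HarnessLib

/-!
# Graded pieces of the weight truncations: `Gr^W_j(W_k X)`, `Gr^W_j(X ∕ W_k X)`, `Gr^W_j(W_{[a,b]} X)`, and the Hodge numbers of `W_{[a,b]} X`

Layer `Literature/AlgebraicGeometry/Motives` (lane `lit-hodgefound`), continuing g44-#5 (`Motives/MixedHodgeStructureCatWeightTruncation`: the
truncations `W_{[a,b]} = W_b ∕ W_{a-1}`).  The tree proves, unbundled, that `Gr^W_j(W_k H) ⥲ Gr^W_j H` for `j ≤ k` and `Gr^W_j H ⥲ Gr^W_j(H ∕ W_k H)`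
for `j > k` (`weight_grMap_subtype_bijective`, `weight_grMap_mkQ_bijective`, `Motives/MixedHodgeStructureGrWSubquotients`; Cattani–El Zein–Griffiths–Lê
Prop. 3.2.19 and Cor. 3.2.21 (ii): `Gr^W_n` is exact), and vanishing in the complementary ranges.  Here these become NATURAL ISOMORPHISMS of
functors `MixedHodgeStructureCat ⥤ HodgeStructureCat j`: **`weightFunctor k ⋙ gr j ≅ gr j` (`j ≤ k`)**, **`gr j ≅ weightQuotFunctor k ⋙ gr j`
(`k < j`)**, hence **`weightTrunc a b ⋙ gr j ≅ gr j` for `j ∈ [a, b]`**, with `Gr^W_j` of the truncations ZERO outside these ranges; and the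
Hodge numbers `h^{p,q}(W_{[a,b]} X) = h^{p,q}(X)` for `a ≤ p + q ≤ b`, `= 0` otherwise.  Everything is PROVED; no named fact is introduced.

Sources, verbatim.  E. Cattani, F. El Zein, P. A. Griffiths, Lê D. T. (eds.), *Hodge Theory* (2014) [CattaniElZeinGriffithsLe2014] (held text
`book:cattani2014-hodge-theory-princeton-mathematical-notes-49`): Prop. 3.2.19 (p0159–p0160, the Deligne splitting `I^{p,q}`, through which sub- and
quotient objects carry induced MHS), Lemma 3.2.20 (p0161 L1–L3: kernels ∕ cokernels «are endowed with induced filtrations (resp. quotient filtrations)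
by W»; «The morphism `Gr^W K → Gr^W H` is injective»), Cor. 3.2.21 (ii) (p0161 L14) «The functor `Gr^W_n` from the category of MHS to the category
`A ⊗ ℚ` HS of weight `n` is exact», §3.2.2.6 (p0162 L14–L20) «The Hodge numbers of H are the Hodge numbers of the Hodge structure on `Gr^W_{p+q} H`».  P. Deligne, *Théorie de
Hodge II* (1971) [DeligneHodgeII1971], Déf. 2.3.1, Thm. 2.3.5 (iii)–(iv) (cited through the tree).

## Main definitions and results

* §1 `isIso_gr_map_weightι_app_of_le`, **`weightFunctorCompGrIso : weightFunctor k ⋙ gr j ≅ gr j` (`j ≤ k`)**, `isZero_gr_obj_weightFunctor_obj_of_lt`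
  (`k < j`); `isIso_gr_map_weightπ_app_of_lt`, **`weightQuotFunctorCompGrIso : weightQuotFunctor k ⋙ gr j ≅ gr j` (`k < j`)**,
  `isZero_gr_obj_weightQuotFunctor_obj_of_le` (`j ≤ k`).
* §2 **`weightTruncCompGrIso : weightTrunc a b ⋙ gr j ≅ gr j` (`a ≤ j ≤ b`)**, `isZero_gr_obj_weightTrunc_obj_of_lt`, `isZero_gr_obj_weightTrunc_obj_of_gt`,
  `isWeight_weightTrunc_obj_iff` (`W_{[a,b]} X` has weight `j` iff `j ∈ [a, b]` and `X` has weight `j`), `setOf_isWeight_weightTrunc_obj`.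
* §3 Hodge numbers: `hodgeNumber_weightFunctor_obj`, `hodgeNumber_weightQuotFunctor_obj`, **`hodgeNumber_weightTrunc_obj`**
  (`h^{p,q}(W_{[a,b]} X) = h^{p,q}(X)` for `a ≤ p + q ≤ b`, else `0`).

## References

* [CattaniElZeinGriffithsLe2014] E. Cattani, F. El Zein, P. A. Griffiths, Lê D. T. (eds.), Hodge Theory, Princeton Math. Notes 49 (2014),
  Prop. 3.2.19, Lemma 3.2.20, Cor. 3.2.21, §3.2.2.6.
* [DeligneHodgeII1971] P. Deligne, Théorie de Hodge II, Publ. Math. IHÉS 40 (1971), Déf. 2.3.1, Thm. 2.3.5.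

## Provenance

Lane `lit-hodgefound` (summit `HodgeConjecture`), seat `lit-hodgefound-p36` (literature-prover, generation 44, row g44-#7).
-/

noncomputable section

open CategoryTheory CategoryTheory.Limits

namespace Literature.AlgebraicGeometry.Motives

universe u

namespace MixedHodgeStructureCat

/-! ## §1 `Gr^W_j` of `W_k X` and of `X ∕ W_k X` -/

/-- **`Gr^W_j(W_k X ↪ X) : Gr^W_j(W_k X) ⥲ Gr^W_j X` is an isomorphism for `j ≤ k`.** [cite: CattaniElZeinGriffithsLe2014, Prop. 3.2.19] -/
theorem isIso_gr_map_weightι_app_of_le {j k : ℤ} (h : j ≤ k) (X : MixedHodgeStructureCat.{u}) : IsIso ((gr j).map ((weightι k).app X)) :=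
  HodgeStructureCat.isIso_of_bijective _ (MixedHodgeStructure.SubMixedHodgeStructure.weight_grMap_subtype_bijective X.str h)

/-- **`W_k ⋙ Gr^W_j ≅ Gr^W_j` for `j ≤ k`** (components `Gr^W_j(W_k X ↪ X)`). [cite: CattaniElZeinGriffithsLe2014, Prop. 3.2.19 and Cor. 3.2.21 (ii)] -/
def weightFunctorCompGrIso {j k : ℤ} (h : j ≤ k) : weightFunctor.{u} k ⋙ gr j ≅ gr j :=
  NatIso.ofComponents (fun X => @asIso _ _ _ _ ((gr j).map ((weightι k).app X)) (isIso_gr_map_weightι_app_of_le h X)) fun f => by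
    change (gr j).map ((weightFunctor k).map f) ≫ (gr j).map ((weightι k).app _) = (gr j).map ((weightι k).app _) ≫ (gr j).map f
    rw [← (gr j).map_comp, ← (gr j).map_comp]
    exact congrArg _ ((weightι k).naturality f)

/-- The components of `weightFunctorCompGrIso h` (by `rfl`). [cite: CattaniElZeinGriffithsLe2014, Prop. 3.2.19] -/
theorem weightFunctorCompGrIso_hom_app {j k : ℤ} (h : j ≤ k) (X : MixedHodgeStructureCat.{u}) :
    (weightFunctorCompGrIso h).hom.app X = (gr j).map ((weightι k).app X) := rfl

/-- **`Gr^W_j(W_k X) = 0` for `k < j`** (`W_k X` has weights `≤ k`). [cite: CattaniElZeinGriffithsLe2014, Prop. 3.2.19] -/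
theorem isZero_gr_obj_weightFunctor_obj_of_lt {j k : ℤ} (h : k < j) (X : MixedHodgeStructureCat.{u}) : IsZero ((gr j).obj ((weightFunctor k).obj X)) :=
  (weightsIn_iff_forall_isZero_gr_obj _ _).1 (weightsIn_Iic_weightFunctor_obj k X) j fun hj => (Set.mem_Iic.1 hj).not_gt h

/-- **`Gr^W_j(X ↠ X ∕ W_k X) : Gr^W_j X ⥲ Gr^W_j(X ∕ W_k X)` is an isomorphism for `k < j`.** [cite: CattaniElZeinGriffithsLe2014, Cor. 3.2.21 (ii)] -/
theorem isIso_gr_map_weightπ_app_of_lt {j k : ℤ} (h : k < j) (X : MixedHodgeStructureCat.{u}) : IsIso ((gr j).map ((weightπ k).app X)) :=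
  HodgeStructureCat.isIso_of_bijective _ (MixedHodgeStructure.SubMixedHodgeStructure.weight_grMap_mkQ_bijective X.str h)

/-- **`(𝟭 ∕ W_k) ⋙ Gr^W_j ≅ Gr^W_j` for `k < j`** (inverse of the components `Gr^W_j(X ↠ X ∕ W_k X)`). [cite: CattaniElZeinGriffithsLe2014, Cor. 3.2.21 (ii)] -/
def weightQuotFunctorCompGrIso {j k : ℤ} (h : k < j) : weightQuotFunctor.{u} k ⋙ gr j ≅ gr j :=
  (NatIso.ofComponents (F := gr j) (G := weightQuotFunctor.{u} k ⋙ gr j)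
    (fun X => @asIso _ _ ((gr j).obj X) ((gr j).obj ((weightQuotFunctor k).obj X)) ((gr j).map ((weightπ k).app X))
      (isIso_gr_map_weightπ_app_of_lt h X))
    fun f => by
      change (gr j).map f ≫ (gr j).map ((weightπ k).app _) = (gr j).map ((weightπ k).app _) ≫ (gr j).map ((weightQuotFunctor k).map f)
      rw [← (gr j).map_comp, ← (gr j).map_comp]
      exact congrArg _ ((weightπ k).naturality f)).symm

/-- The components of `(weightQuotFunctorCompGrIso h).inv` are `Gr^W_j(X ↠ X ∕ W_k X)` (by `rfl`). [cite: CattaniElZeinGriffithsLe2014, Cor. 3.2.21 (ii)] -/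
theorem weightQuotFunctorCompGrIso_inv_app {j k : ℤ} (h : k < j) (X : MixedHodgeStructureCat.{u}) :
    (weightQuotFunctorCompGrIso h).inv.app X = (gr j).map ((weightπ k).app X) := rfl

/-- **`Gr^W_j(X ∕ W_k X) = 0` for `j ≤ k`** (`X ∕ W_k X` has weights `> k`). [cite: CattaniElZeinGriffithsLe2014, Cor. 3.2.21 (ii)] -/
theorem isZero_gr_obj_weightQuotFunctor_obj_of_le {j k : ℤ} (h : j ≤ k) (X : MixedHodgeStructureCat.{u}) : IsZero ((gr j).obj ((weightQuotFunctor k).obj X)) :=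
  (weightsIn_iff_forall_isZero_gr_obj _ _).1 (weightsIn_Ioi_weightQuotFunctor_obj k X) j fun hj => (Set.mem_Ioi.1 hj).not_ge h

/-- `j` is a weight of `X` iff `Gr^W_j X ≠ 0`. [cite: DeligneHodgeII1971, Déf. 2.3.1] -/
theorem isWeight_iff_not_isZero_gr_obj (j : ℤ) (X : MixedHodgeStructureCat.{u}) : X.str.IsWeight j ↔ ¬IsZero ((gr j).obj X) := by
  rw [isZero_gr_obj_iff_not_isWeight, not_not]

/-! ## §2 `Gr^W_j` of `W_{[a,b]} X` -/

/-- **`W_{[a,b]} ⋙ Gr^W_j ≅ Gr^W_j` for `a ≤ j ≤ b`** (`Gr^W_j(W_b X ∕ W_{a-1}(W_b X)) ≅ Gr^W_j(W_b X) ≅ Gr^W_j X`).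
[cite: CattaniElZeinGriffithsLe2014, Prop. 3.2.19 and Cor. 3.2.21 (ii)] -/
def weightTruncCompGrIso {a b j : ℤ} (ha : a ≤ j) (hb : j ≤ b) : weightTrunc.{u} a b ⋙ gr j ≅ gr j :=
  Functor.associator _ _ _ ≪≫ Functor.isoWhiskerLeft (weightFunctor b) (weightQuotFunctorCompGrIso (show a - 1 < j by omega)) ≪≫
    weightFunctorCompGrIso hb

/-- **`Gr^W_j(W_{[a,b]} X) = 0` for `j < a`.** [cite: CattaniElZeinGriffithsLe2014, Prop. 3.2.19] -/
theorem isZero_gr_obj_weightTrunc_obj_of_lt {a b j : ℤ} (h : j < a) (X : MixedHodgeStructureCat.{u}) : IsZero ((gr j).obj ((weightTrunc a b).obj X)) :=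
  (weightsIn_iff_forall_isZero_gr_obj _ _).1 (weightsIn_Icc_weightTrunc_obj a b X) j fun hj => by
    have := (Set.mem_Icc.1 hj).1; omega

/-- **`Gr^W_j(W_{[a,b]} X) = 0` for `b < j`.** [cite: CattaniElZeinGriffithsLe2014, Prop. 3.2.19] -/
theorem isZero_gr_obj_weightTrunc_obj_of_gt {a b j : ℤ} (h : b < j) (X : MixedHodgeStructureCat.{u}) : IsZero ((gr j).obj ((weightTrunc a b).obj X)) :=
  (weightsIn_iff_forall_isZero_gr_obj _ _).1 (weightsIn_Icc_weightTrunc_obj a b X) j fun hj => by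
    have := (Set.mem_Icc.1 hj).2; omega

/-- **`j` is a weight of `W_{[a,b]} X` iff `a ≤ j ≤ b` and `j` is a weight of `X`.** [cite: CattaniElZeinGriffithsLe2014, Prop. 3.2.19 and Cor. 3.2.21 (ii)] -/
theorem isWeight_weightTrunc_obj_iff (a b j : ℤ) (X : MixedHodgeStructureCat.{u}) :
    ((weightTrunc a b).obj X).str.IsWeight j ↔ j ∈ Set.Icc a b ∧ X.str.IsWeight j := by
  constructor
  · intro hj
    have hmem : j ∈ Set.Icc a b := weightsIn_Icc_weightTrunc_obj a b X hj
    refine ⟨hmem, ?_⟩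
    rw [isWeight_iff_not_isZero_gr_obj] at hj ⊢
    exact fun h0 => hj (h0.of_iso ((weightTruncCompGrIso (Set.mem_Icc.1 hmem).1 (Set.mem_Icc.1 hmem).2).app X))
  · rintro ⟨hmem, hj⟩
    rw [isWeight_iff_not_isZero_gr_obj] at hj ⊢
    exact fun h0 => hj (h0.of_iso ((weightTruncCompGrIso (Set.mem_Icc.1 hmem).1 (Set.mem_Icc.1 hmem).2).app X).symm)

/-- The set of weights of `W_{[a,b]} X` is `[a, b] ∩ (weights of X)`. [cite: CattaniElZeinGriffithsLe2014, Prop. 3.2.19 and Cor. 3.2.21 (ii)] -/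
theorem setOf_isWeight_weightTrunc_obj (a b : ℤ) (X : MixedHodgeStructureCat.{u}) :
    {j | ((weightTrunc a b).obj X).str.IsWeight j} = Set.Icc a b ∩ {j | X.str.IsWeight j} :=
  Set.ext fun j => isWeight_weightTrunc_obj_iff a b j X

/-- Likewise `j` is a weight of `W_k X` iff `j ≤ k` and `j` is a weight of `X`. [cite: CattaniElZeinGriffithsLe2014, Prop. 3.2.19] -/
theorem isWeight_weightFunctor_obj_iff (k j : ℤ) (X : MixedHodgeStructureCat.{u}) :
    ((weightFunctor k).obj X).str.IsWeight j ↔ j ≤ k ∧ X.str.IsWeight j := by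
  constructor
  · intro hj
    exact ⟨Set.mem_Iic.1 (weightsIn_Iic_weightFunctor_obj k X hj), MixedHodgeStructure.SubMixedHodgeStructure.isWeight_of_isWeight_weight X.str hj⟩
  · rintro ⟨hjk, hj⟩
    exact (MixedHodgeStructure.SubMixedHodgeStructure.isWeight_weight_iff X.str hjk).2 hj

/-- Likewise `j` is a weight of `X ∕ W_k X` iff `k < j` and `j` is a weight of `X`. [cite: CattaniElZeinGriffithsLe2014, Cor. 3.2.21 (ii)] -/
theorem isWeight_weightQuotFunctor_obj_iff (k j : ℤ) (X : MixedHodgeStructureCat.{u}) :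
    ((weightQuotFunctor k).obj X).str.IsWeight j ↔ k < j ∧ X.str.IsWeight j := by
  constructor
  · intro hj
    have hkj : k < j := Set.mem_Ioi.1 (weightsIn_Ioi_weightQuotFunctor_obj k X hj)
    refine ⟨hkj, ?_⟩
    rw [isWeight_iff_not_isZero_gr_obj] at hj ⊢
    exact fun h0 => hj (h0.of_iso ((weightQuotFunctorCompGrIso hkj).app X))
  · rintro ⟨hkj, hj⟩
    rw [isWeight_iff_not_isZero_gr_obj] at hj ⊢
    exact fun h0 => hj (h0.of_iso ((weightQuotFunctorCompGrIso hkj).app X).symm)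

/-! ## §3 Hodge numbers of the truncations -/

/-- `h^{p,q}(W_k X) = h^{p,q}(X)` for `p + q ≤ k` and `0` otherwise. [cite: CattaniElZeinGriffithsLe2014, Prop. 3.2.19 and §3.2.2.6] -/
theorem hodgeNumber_weightFunctor_obj (k : ℤ) (X : MixedHodgeStructureCat.{u}) [Module.Finite ℚ X] (p q : ℤ) :
    ((weightFunctor k).obj X).str.hodgeNumber p q = if p + q ≤ k then X.str.hodgeNumber p q else 0 := by
  split_ifs with h
  · exact MixedHodgeStructure.SubMixedHodgeStructure.hodgeNumber_weight_of_le X.str h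
  · exact MixedHodgeStructure.SubMixedHodgeStructure.hodgeNumber_weight_of_lt X.str (lt_of_not_ge h)

/-- `h^{p,q}(X ∕ W_k X) = h^{p,q}(X)` for `k < p + q` and `0` otherwise. [cite: CattaniElZeinGriffithsLe2014, Cor. 3.2.21 (ii) and §3.2.2.6] -/
theorem hodgeNumber_weightQuotFunctor_obj (k : ℤ) (X : MixedHodgeStructureCat.{u}) [Module.Finite ℚ X] (p q : ℤ) :
    ((weightQuotFunctor k).obj X).str.hodgeNumber p q = if k < p + q then X.str.hodgeNumber p q else 0 := by
  split_ifs with h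
  · exact MixedHodgeStructure.SubMixedHodgeStructure.hodgeNumber_weight_quotient_of_lt X.str h
  · exact MixedHodgeStructure.SubMixedHodgeStructure.hodgeNumber_weight_quotient_of_le X.str (le_of_not_gt h)

/-- **`h^{p,q}(W_{[a,b]} X) = h^{p,q}(X)` for `a ≤ p + q ≤ b` and `0` otherwise.** [cite: CattaniElZeinGriffithsLe2014, Cor. 3.2.21 (ii) and §3.2.2.6] -/
theorem hodgeNumber_weightTrunc_obj (a b : ℤ) (X : MixedHodgeStructureCat.{u}) [Module.Finite ℚ X] (p q : ℤ) :
    ((weightTrunc a b).obj X).str.hodgeNumber p q = if a ≤ p + q ∧ p + q ≤ b then X.str.hodgeNumber p q else 0 := by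
  haveI : Module.Finite ℚ ((weightFunctor b).obj X) := inferInstanceAs (Module.Finite ℚ ↥(X.str.W b))
  rw [weightTrunc_obj, hodgeNumber_weightQuotFunctor_obj, hodgeNumber_weightFunctor_obj]
  by_cases ha : a ≤ p + q <;> by_cases hb : p + q ≤ b <;> simp [ha, hb, show (a - 1 < p + q) ↔ a ≤ p + q by omega]

end MixedHodgeStructureCat

end Literature.AlgebraicGeometry.Motives

end
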